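import Summits.BirchSwinnertonDyer.Rank1Residual.AdditivePotMult.TwistSupplyJ
import Summits.BirchSwinnertonDyer.Rank1Residual.AdditivePotMult.TwistSupply
import Summits.BirchSwinnertonDyer.Rank1Residual.Additive.QuadraticTwistSurj
import Literature.NumberTheory.EllipticCurves.BSDSelmerPConverseRamifiedProofs
import Literature.NumberTheory.EllipticCurves.Kato2004.Condition1252
import HarnessLib

/-!
# `ρ̄_{E,p^n}` onto for all `n` from surj(p) and ONE `j`-WITNESS — a prime `q ≠ p` with
# `ord_q j(E) < 0` and `p ∤ ord_q j(E)` (multiplicative OR additive potentially multiplicative `q`),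
# for every prime `p` (cell `b2b-bsdres`, seat additive-p4, line V21)

HONEST FRAMING (cell `b2b-bsdres`, run/shared/lean/b2b/bsd-rank1-residual/, verbatim in every
file): the goal of the cell is to DELETE the COMBINATION-SHAPED residual classes of the
Birch–Swinnerton-Dyer formula for ALL analytic-rank `≤ 1` elliptic curves over `ℚ` — "full BSD
formula for every rank `≤ 1` curve in class `C`" assembled STRICTLY from published theorems — so
that the rank-`≤ 1` remainder becomes exactly the CONSTRUCTION-SHAPED classes, which are TYPED
(missing-input `Prop`s), NOT attempted. This is not "finishing BSD". Sub-cell additive-p4 (X3♯/X4♯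
direct): research route; no claim beyond the stated classes; class labels UNCHANGED; nothing booked.
Theorems only — no definition, no named fact.

## What this file proves

The tree's tower-surjectivity lever
`hasSurjectiveModNGaloisRep_pow_of_hasMultiplicativeReductionAtPrime` (surj(p) ∧ a MULTIPLICATIVE
prime `ℓ ≠ p` with `p ∤ v_ℓ(Δ_min)` ⟹ `ρ̄_{E,p^n}` onto ∀ `n`, every prime `p`; the inertia at `ℓ`
supplies a transvection, and the transvection form of Serre's lifting lemma needs no hypothesis on
`p`) is extended from multiplicative to POTENTIALLY multiplicative witnesses, in the cell's
`j`-witness currency (`AdditivePotMult/TwistSupplyJ.lean`):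

* `exists_addEquiv_sq_eq_neg_pow` — `-1` is a square in `Aut(E[p^n])` (`n ≥ 1`): the quarter turn
  `(0 -1; 1 0)` in a frame `E[p^n] ≅ (ℤ/p^n)²` (`nonempty_addEquiv_geomTorsion`).
* `hasSurjectiveModNGaloisRep_pow_of_addEquiv_signed` — surjectivity of `ρ̄_{E,p^n}` passes
  through an additive isomorphism `E₁(ℚ̄) ≃+ E₂(ℚ̄)` that is `Γ_ℚ`-equivariant up to sign at each
  `σ` (the prime-level case is the tree's
  `twistAdmissible_hasSurjectiveModNGaloisRep_of_addEquiv_signed`; the group theory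
  `twistAdmissible_surjective_toAddAut_of_signEquivariant` is level-free: squares lie in the
  twisted image, `-1 = J²` is a square, so `±image = image`).
* `hasSurjectiveModNGaloisRep_pow_quadraticTwist_iff`, `…_pow_iff_of_model_twist` — `ρ̄_{E^{(d)},p^n}`
  onto ⟺ `ρ̄_{E,p^n}` onto, on any `ℚ`-model of the twist (Silverman *AEC* X.5.4:
  `E^{(d)}[m] ≅ E[m] ⊗ χ_d`).
* **`hasSurjectiveModNGaloisRep_pow_of_surj_of_jWitness`** — for `E/ℚ` (ANY model), a prime `p`,
  `ρ̄_{E,p}` onto, and a prime `q ≠ p` with `ord_q j(E) < 0` and `p ∤ ord_q j(E)`: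
  `ρ̄_{E,p^n}` is onto for every `n`. Proof: some quadratic twist `E^{(d)}` is MULTIPLICATIVE at `q`
  (`exists_twist_mult_of_padicValRat_j_neg`, Silverman *ATAEC* V.5.3); on its globally minimal
  model `V`, `ord_q Δ_min(V) = −ord_q j(E)` (`dvd_padicValInt_minimalDiscriminantInt_iff_of_mult`,
  `j` is a twist invariant), so `V` satisfies (ram) at `p`; `ρ̄_{V,p}` is onto (twist invariance at
  prime level, `surj_iff_of_model_twist`); hence `ρ̄_{V,p^n}` is onto (the multiplicative lever) and
  so is `ρ̄_{E,p^n}` (twist invariance at level `p^n`). When `q` is multiplicative for `E` this is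
  the old lever (a (ram)-witness IS a `j`-witness, `exists_jWitness_of_ram`); the new case is an
  ADDITIVE potentially multiplicative `q` (Kodaira `I_n^*`, `p ∤ n`), whose inertia acts through
  `±(1 *; 0 1)`.
* `imageContainsSL2_of_surj_of_jWitness` — hence Kato's (12.5.2) (`Kato2004.ImageContainsSL2 W p`).
* `hasSurjectiveModNGaloisRep_pow_of_surj_of_ram'` — the (ram) form restated through the
  `j`-witness (sanity / uniformity).

Use (line V21 of the seat, `Additive/X4SharpThreeAssembly.lean`): at `p = 3`, where surj(3) does NOT
lift by itself (Elkies 2006), the X4♯(3) routes (Kato 14.5 (3), Kim–Nakamura 1.7) need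
`ρ̄_{E,3^n}` onto; the census bit "(ram) prime" misses the rows whose transvection comes from an
additive potentially multiplicative prime — 10 of the 46 such window rows, 1 445 of the 2 939 sweep
rows (seat census V21). Labels UNCHANGED; nothing booked.

References: J.-P. Serre, *Abelian ℓ-adic representations* (1968) IV §3.4 Lemma 3, A.1.2;
J.-P. Serre, Invent. Math. 15 (1972) §1.12, §4; J. H. Silverman, *AEC* X.2 Prop. 2.4, X.5 Cor. 5.4,
VII.5.1; *ATAEC* V.5.3; N. Elkies, arXiv:math/0612734 (2006); Burungale–Skinner–Tian–Wan,
arXiv:2409.01350, Part II (sur), (ram).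
-/

noncomputable section

open scoped Classical

open WeierstrassCurve Literature.NumberTheory.EllipticCurves
  Literature.NumberTheory.EllipticCurves.Rank1Residual
  Summit.BirchSwinnertonDyer.BirchSwinnertonDyer.Theorems

namespace Summit.BirchSwinnertonDyer.Rank1Residual.GaloisImage

/-! ### `-1` is a square in `Aut(E[p^n])` -/

/-- **`-1` is a square in `Aut(E[p^n])`** (`n ≥ 1`): in a frame `E[p^n] ≅ (ℤ/p^n ℤ)²`
(`nonempty_addEquiv_geomTorsion`, Silverman *AEC* III.6.4 (b)) take the quarter turn
`J = (0 -1; 1 0)`, `J ∘ J = -1`. [cite: SilvermanAEC2009, Cor. III.6.4(b)] -/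
theorem exists_addEquiv_sq_eq_neg_pow (W : WeierstrassCurve ℚ) [W.IsElliptic] (p : ℕ)
    [Fact p.Prime] (n : ℕ) (hn : 1 ≤ n) :
    ∃ g : geomTorsion W ((p ^ n : ℕ) : ℤ) ≃+ geomTorsion W ((p ^ n : ℕ) : ℤ), ∀ P, g (g P) = -P := by
  have hp : p.Prime := Fact.out
  have hpQ : (p : ℚ) ≠ 0 := Nat.cast_ne_zero.mpr hp.ne_zero
  obtain ⟨e⟩ := nonempty_addEquiv_geomTorsion W p n hn hpQ
  obtain ⟨J, hJ⟩ := twistAdmissible_exists_quarterTurn (ZMod (p ^ n))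
  refine ⟨e.trans (J.trans e.symm), fun P ↦ ?_⟩
  simp only [AddEquiv.trans_apply, AddEquiv.apply_symm_apply, hJ, map_neg,
    AddEquiv.symm_apply_apply]

/-! ### Surjectivity of `ρ̄_{E,p^n}` through a sign-twisted isomorphism -/

/-- **Surjectivity of `ρ̄_{E,p^n}` is invariant under twisting by a quadratic character.** If
`f : E₁(ℚ̄) ≃+ E₂(ℚ̄)` is additive and, at every `σ ∈ Γ_ℚ`, equivariant or anti-equivariant
(`f(σP) = ±σ f(P)`), then `ρ̄_{E₂,p^n}` onto implies `ρ̄_{E₁,p^n}` onto (`E₂` elliptic): restrict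
`f` to `E₁[p^n] ≃+ E₂[p^n]` and apply the level-free group theory
`twistAdmissible_surjective_toAddAut_of_signEquivariant` with `-1 = J²` in `Aut(E₂[p^n])`
(`exists_addEquiv_sq_eq_neg_pow`); level `p^0 = 1` is trivial. [cite: Serre1972, §4] -/
theorem hasSurjectiveModNGaloisRep_pow_of_addEquiv_signed {W₁ W₂ : WeierstrassCurve ℚ}
    [W₂.IsElliptic] (f : geomPoints W₁ ≃+ geomPoints W₂)
    (hf : ∀ σ : Field.absoluteGaloisGroup ℚ,
      (∀ P, f (σ • P) = σ • f P) ∨ (∀ P, f (σ • P) = -(σ • f P)))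
    (p : ℕ) [Fact p.Prime] (n : ℕ) (h : W₂.HasSurjectiveModNGaloisRep (p ^ n : ℕ)) :
    W₁.HasSurjectiveModNGaloisRep (p ^ n : ℕ) := by
  rcases Nat.eq_zero_or_pos n with rfl | hn
  · haveI : Subsingleton (geomTorsion W₁ ((p ^ 0 : ℕ) : ℤ)) := ⟨fun a b ↦ by
      have ha := AddSubgroup.torsionBy.nsmul_iff.mp a.2
      have hb := AddSubgroup.torsionBy.nsmul_iff.mp b.2
      simp only [pow_zero, one_smul] at ha hb
      exact Subtype.ext (ha.trans hb.symm)⟩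
    intro y
    exact ⟨1, Multiplicative.toAdd.injective (AddEquiv.ext fun a ↦ Subsingleton.elim _ _)⟩
  · obtain ⟨g, hg⟩ := exists_addEquiv_sq_eq_neg_pow W₂ p n hn
    let e : geomTorsion W₁ ((p ^ n : ℕ) : ℤ) ≃+ geomTorsion W₂ ((p ^ n : ℕ) : ℤ) :=
      torsionByEquiv f (p ^ n)
    have he : ∀ P : geomTorsion W₁ ((p ^ n : ℕ) : ℤ),
        ((e P : geomTorsion W₂ ((p ^ n : ℕ) : ℤ)) : geomPoints W₂) = f P := fun _ ↦ rfl
    refine twistAdmissible_surjective_toAddAut_of_signEquivariant e (fun σ ↦ ?_) g hg h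
    rcases hf σ with hs | hs
    · left
      intro P
      apply Subtype.ext
      rw [he, AddSubgroup.torsionBy.coe_smul, hs, AddSubgroup.torsionBy.coe_smul, he]
    · right
      intro P
      apply Subtype.ext
      rw [he, AddSubgroup.torsionBy.coe_smul, hs, AddSubgroup.coe_neg,
        AddSubgroup.torsionBy.coe_smul, he]

/-- **`ρ̄_{E^{(d)},p^n}` onto ⟺ `ρ̄_{E,p^n}` onto**, for every prime `p`, `n : ℕ` and `d ∈ ℚ^×`: the
twisting isomorphism `E^{(d)}(ℚ̄) ≃+ E(ℚ̄)` is `χ_d`-equivariant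
(`exists_addEquiv_geomPoints_quadraticTwist_signed`, Silverman *AEC* X.5 Cor. 5.4), and so is its
inverse. [cite: SilvermanAEC2009, X.5 Cor. 5.4 and X.2 Prop. 2.4] -/
theorem hasSurjectiveModNGaloisRep_pow_quadraticTwist_iff (W : WeierstrassCurve ℚ) [W.IsElliptic]
    (p : ℕ) [Fact p.Prime] {d : ℚ} (hd : d ≠ 0) (n : ℕ) :
    haveI := W.isElliptic_quadraticTwist hd
    (W.quadraticTwist d).HasSurjectiveModNGaloisRep (p ^ n : ℕ) ↔
      W.HasSurjectiveModNGaloisRep (p ^ n : ℕ) := by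
  haveI := W.isElliptic_quadraticTwist hd
  haveI : NeZero (2 : ℚ) := ⟨two_ne_zero⟩
  obtain ⟨f, hf⟩ := W.exists_addEquiv_geomPoints_quadraticTwist_signed hd
  have hf' : ∀ σ : Field.absoluteGaloisGroup ℚ,
      (∀ Q, f.symm (σ • Q) = σ • f.symm Q) ∨ (∀ Q, f.symm (σ • Q) = -(σ • f.symm Q)) := by
    intro σ
    rcases hf σ with h | h
    · left
      intro Q
      apply f.injective
      rw [AddEquiv.apply_symm_apply, h, AddEquiv.apply_symm_apply]
    · right
      intro Q
      apply f.injective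
      rw [AddEquiv.apply_symm_apply, map_neg, h, AddEquiv.apply_symm_apply, neg_neg]
  exact ⟨fun h ↦ hasSurjectiveModNGaloisRep_pow_of_addEquiv_signed f.symm hf' p n h,
    fun h ↦ hasSurjectiveModNGaloisRep_pow_of_addEquiv_signed f hf p n h⟩

/-- **Level `p^n` surjectivity for any `ℚ`-model of the twist**: if `C • E^{(d)} = Wd` over `ℚ` then
`ρ̄_{Wd,p^n}` onto ⟺ `ρ̄_{E,p^n}` onto (model independence: `hasSurjectiveModNGaloisRep_smul_iff`).
[cite: SilvermanAEC2009, X.5 Cor. 5.4] -/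
theorem hasSurjectiveModNGaloisRep_pow_iff_of_model_twist (W : WeierstrassCurve ℚ) [W.IsElliptic]
    (p : ℕ) [Fact p.Prime] {d : ℚ} (hd : d ≠ 0) {Wd : WeierstrassCurve ℚ}
    (hWd : ∃ C : VariableChange ℚ, C • W.quadraticTwist d = Wd) (n : ℕ) :
    Wd.HasSurjectiveModNGaloisRep (p ^ n : ℕ) ↔ W.HasSurjectiveModNGaloisRep (p ^ n : ℕ) := by
  obtain ⟨C, rfl⟩ := hWd
  rw [hasSurjectiveModNGaloisRep_smul_iff]
  exact hasSurjectiveModNGaloisRep_pow_quadraticTwist_iff W p hd n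

/-! ### Tower surjectivity from surj(p) and a `j`-witness -/

/-- **surj(p) + one `j`-WITNESS ⟹ `ρ̄_{E,p^n}` onto for every `n`, every prime `p`.** For `E/ℚ`
(any Weierstrass model `W`), a prime `p` with `ρ̄_{E,p}` onto, and a prime `q ≠ p` with
`ord_q j(E) < 0` and `p ∤ ord_q j(E)` — `q` multiplicative for `E`, or additive potentially
multiplicative (Kodaira `I_n^*` with `p ∤ n`) —: `ρ̄_{E,p^n} : Γ_ℚ → Aut(E[p^n])` is onto for all `n`.
Twist to a `q`-multiplicative quadratic twist (Silverman *ATAEC* V.5.3), whose globally minimal model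
satisfies (ram) at `p` because `ord_q Δ_min = −ord_q j` there (*AEC* VII.5.1 (b)) and whose mod-`p`
representation is onto (twist invariance); apply the multiplicative lever
`hasSurjectiveModNGaloisRep_pow_of_hasMultiplicativeReductionAtPrime` (Tate-curve transvection +
the transvection form of Serre's lifting lemma, all `p`); untwist at level `p^n`
(`hasSurjectiveModNGaloisRep_pow_iff_of_model_twist`).
[cite: SilvermanATAEC1994, V.5.3 and Exercise 5.13(b) (PDF p. 416)]
[cite: SerreAbelianLadic1968, Ch. IV §3.4, Lemma 3 and A.1.2] [cite: SilvermanAEC2009, X.5 Cor. 5.4, VII.5 Prop. 5.1(b)] -/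
theorem hasSurjectiveModNGaloisRep_pow_of_surj_of_jWitness (W : WeierstrassCurve ℚ) [W.IsElliptic]
    (p : ℕ) [Fact p.Prime] (hsurj : Surj W p)
    (hJ : ∃ q : ℕ, q.Prime ∧ q ≠ p ∧ padicValRat q W.j < 0 ∧ ¬ (p : ℤ) ∣ padicValRat q W.j)
    (n : ℕ) : W.HasSurjectiveModNGaloisRep (p ^ n : ℕ) := by
  obtain ⟨q, hq, hqp, hneg, hndvd⟩ := hJ
  haveI : Fact q.Prime := ⟨hq⟩
  obtain ⟨d, hd0, hmultd⟩ :=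
    AdditivePotMult.exists_twist_mult_of_padicValRat_j_neg (W := W) (q := q) hneg
  obtain ⟨V, _, _, C, hC⟩ := AdditivePotMult.exists_globallyMinimal_model_twist W hd0
  have hWd : ∃ C : VariableChange ℚ, C • W.quadraticTwist d = V := ⟨C, hC⟩
  have hmultV : Mult V q := AdditivePotMult.mult_of_model_twist hd0 hmultd hWd
  have hjV : V.j = W.j := AdditivePotMult.j_of_model_twist hd0 hWd
  have hramV : ∃ ℓ : ℕ, ∃ _ : Fact ℓ.Prime, ℓ ≠ p ∧ V.HasMultiplicativeReductionAtPrime ℓ ∧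
      ¬ p ∣ padicValInt ℓ V.minimalDiscriminantInt := by
    refine ⟨q, ‹Fact q.Prime›, hqp, hmultV, ?_⟩
    rw [AdditivePotMult.dvd_padicValInt_minimalDiscriminantInt_iff_of_mult V q hmultV p, hjV]
    exact hndvd
  have hsurjV : Surj V p := (Additive.surj_iff_of_model_twist W p hd0 hWd).mpr hsurj
  exact (hasSurjectiveModNGaloisRep_pow_iff_of_model_twist W p hd0 hWd n).mp
    (hasSurjectiveModNGaloisRep_pow_of_hasMultiplicativeReductionAtPrime V p hsurjV hramV n)

/-- **Kato's (12.5.2) from surj(p) and a `j`-witness**: `ρ_{E,p^∞}(Γ_ℚ) ⊇ SL₂(ℤ_p)` in Kato's sense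
(`Kato2004.ImageContainsSL2 W p`, tree `imageContainsSL2_of_forall_hasSurjectiveModNGaloisRep`).
[cite: Kato2004Asterisque, (12.5.2) in Thm. 12.5 (4) (p. 222)] -/
theorem imageContainsSL2_of_surj_of_jWitness (W : WeierstrassCurve ℚ) [W.IsElliptic]
    (p : ℕ) [Fact p.Prime] (hsurj : Surj W p)
    (hJ : ∃ q : ℕ, q.Prime ∧ q ≠ p ∧ padicValRat q W.j < 0 ∧ ¬ (p : ℤ) ∣ padicValRat q W.j) :
    Kato2004.ImageContainsSL2 W p :=
  Kato2004.imageContainsSL2_of_forall_hasSurjectiveModNGaloisRep W p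
    (hasSurjectiveModNGaloisRep_pow_of_surj_of_jWitness W p hsurj hJ)

/-- **The (ram) lever is the multiplicative case of the `j`-witness lever** (uniformity check: a
(ram)-witness of a globally minimal `W` is a `j`-witness, `AdditivePotMult.exists_jWitness_of_ram`).
[cite: BurungaleSkinnerTianWan2024, Part II (sur), (ram) (p. 74)] -/
theorem hasSurjectiveModNGaloisRep_pow_of_surj_of_ram' (W : WeierstrassCurve ℚ) [W.IsElliptic]
    [W.IsGloballyMinimal] (p : ℕ) [Fact p.Prime] (hsurj : Surj W p) (hram : Ram W p) (n : ℕ) :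
    W.HasSurjectiveModNGaloisRep (p ^ n : ℕ) :=
  hasSurjectiveModNGaloisRep_pow_of_surj_of_jWitness W p hsurj
    (AdditivePotMult.exists_jWitness_of_ram (W := W) (p := p) hram) n

/-- **No `j`-witness and no (ram): the dichotomy's other side is decidable from the `j`-invariant
alone** — if every prime `q ≠ p` with `ord_q j(E) < 0` has `p ∣ ord_q j(E)` then in particular
`¬ Ram W p` (`AdditivePotMult.not_ram_of_forall_dvd`); recorded so that census engines may test the
single predicate "`∃ q ≠ p`, `ord_q j < 0`, `p ∤ ord_q j`" on the a-invariants of ANY model.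
[folklore] -/
theorem not_ram_of_no_jWitness (W : WeierstrassCurve ℚ) [W.IsElliptic] [W.IsGloballyMinimal]
    (p : ℕ) [Fact p.Prime]
    (hall : ∀ q : ℕ, q.Prime → q ≠ p → padicValRat q W.j < 0 → (p : ℤ) ∣ padicValRat q W.j) :
    ¬ Ram W p :=
  AdditivePotMult.not_ram_of_forall_dvd (W := W) (p := p) hall

/-! ### The contrapositive: structure of an EXOTIC `p`-adic image (mod `p` onto, some level `p^n` not) -/

/-- **An exotic `p`-adic image has NO `j`-witness**: if `ρ̄_{E,p}` is onto but `ρ̄_{E,p^n}` is not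
(at `p = 3`: Elkies' mod-3-not-mod-9 curves, arXiv:math/0612734), then EVERY prime `q ≠ p` with
`ord_q j(E) < 0` has `p ∣ ord_q j(E)` — every (potentially) multiplicative prime of `E` has a Tate
parameter whose valuation is divisible by `p`. (Contrapositive of
`hasSurjectiveModNGaloisRep_pow_of_surj_of_jWitness`.) Census check (seat additive-p4 gen 13, V21b,
two mod-9 engines): the 20 X4 ∧ `p = 3` ∧ `r_an = 0` curves of the S-b sweep (N < 5·10⁵) with
surj(3) ∧ ¬surj(9) have `j ∈ {15786448344, 4374, −44789760}` — three INTEGERS, no pole at all.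
[cite: SilvermanATAEC1994, V.5.3 and Exercise 5.13(b) (PDF p. 416)] -/
theorem dvd_padicValRat_j_of_surj_of_not_surj_pow (W : WeierstrassCurve ℚ) [W.IsElliptic]
    (p : ℕ) [Fact p.Prime] (hsurj : Surj W p) {n : ℕ}
    (hnot : ¬ W.HasSurjectiveModNGaloisRep (p ^ n : ℕ)) {q : ℕ} (hq : q.Prime) (hqp : q ≠ p)
    (hneg : padicValRat q W.j < 0) : (p : ℤ) ∣ padicValRat q W.j := by
  by_contra hnd
  exact hnot (hasSurjectiveModNGaloisRep_pow_of_surj_of_jWitness W p hsurj ⟨q, hq, hqp, hneg, hnd⟩ n)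

/-- **An exotic `p`-adic image has NO (ram) prime**: on a globally minimal model, if `ρ̄_{E,p}` is
onto but some `ρ̄_{E,p^n}` is not, then every multiplicative prime `ℓ ≠ p` of `E` has
`p ∣ v_ℓ(Δ_min)` (Skinner–Urban's (ram) FAILS at `p`). [cite: BurungaleSkinnerTianWan2024, Part II (sur), (ram) (p. 74)] -/
theorem not_ram_of_surj_of_not_surj_pow (W : WeierstrassCurve ℚ) [W.IsElliptic]
    [W.IsGloballyMinimal] (p : ℕ) [Fact p.Prime] (hsurj : Surj W p) {n : ℕ}
    (hnot : ¬ W.HasSurjectiveModNGaloisRep (p ^ n : ℕ)) : ¬ Ram W p :=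
  fun hram ↦ hnot (hasSurjectiveModNGaloisRep_pow_of_surj_of_ram' W p hsurj hram n)

/-- **At `p = 3` in mod-9 currency**: surj(3) ∧ ¬surj(9) ⟹ `3 ∣ ord_q j(E)` at every prime `q ≠ 3`
with `ord_q j(E) < 0`. [cite: SilvermanATAEC1994, V.5.3] -/
theorem dvd_padicValRat_j_of_surj_three_of_not_surj_nine (W : WeierstrassCurve ℚ) [W.IsElliptic]
    (hsurj : Surj W 3) (h9 : ¬ W.HasSurjectiveModNGaloisRep 9) {q : ℕ} (hq : q.Prime) (hq3 : q ≠ 3)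
    (hneg : padicValRat q W.j < 0) : (3 : ℤ) ∣ padicValRat q W.j := by
  haveI : Fact (Nat.Prime 3) := ⟨Nat.prime_three⟩
  have h9' : ¬ W.HasSurjectiveModNGaloisRep (3 ^ 2 : ℕ) := by
    rw [show ((3 ^ 2 : ℕ) : ℤ) = 9 by norm_num]; exact h9
  exact_mod_cast dvd_padicValRat_j_of_surj_of_not_surj_pow W 3 hsurj h9' hq hq3 hneg

end Summit.BirchSwinnertonDyer.Rank1Residual.GaloisImage

end
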